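import Summits.NavierStokesRegularity.FunctionalMining.ConvexWeightGradient
import HarnessLib

/-!
# FunctionalMining — the convexity gain of a POWER weight `W = ψ^q` for EVERY real `q ≥ 0`:
# `∫ DW(Θ)[ΔΘ] ≤ −q(q−1) ∫ ψ(Θ)^{q−2}|∇(ψ∘Θ)|² = −(4(q−1)/q) ∫ |∇(ψ^{q/2}∘Θ)|²`

Search for candidate a priori estimates; no regularity claim. Cell `pub-nsfunc`, prove seat
(gen 29). `ConvexWeightGradient.lean` proves the "convexity gain" of SIEVELD §3.4 (b) (Theorem G (ii),
nogo N14) for SQUARED weights `W = ψ²` with `ψ` convex: `∫ DW(Θ)[ΔΘ] ≤ −2∫|∇(ψ∘Θ)|²`; the `T_LD`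
template (`TopEigBalanceTLD`, `TopEigSaturatingSup`) applies it to `W_φ = g̃_φ^q = (g̃_φ^{q/2})²`, which
needs `g̃_φ^{q/2}` convex, i.e. `q ≥ 2` (site (T-1) of the dictionary's §14d (LL-BQ)). THIS FILE types the
repair recorded there as "REPAIRABLE on paper for every real q > 1 … pen, not typed": for a weight that is
a real POWER of a convex `C²` function that is POSITIVE along the field, the Hessian form
`D²(ψ^q) ≥ q(q−1)ψ^{q−2} Dψ ⊗ Dψ` gives the gain directly, with no convexity of `ψ^{q/2}`:

* **`ConvexWeight.integral_rpow_mul_fderiv_partialDeriv_partialDeriv_le`** — one direction: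
  `∫ ψ(Θ)^{q−1}·Dψ(Θ)[∂ₖ∂ₖΘ] ≤ −(q−1) ∫ ψ(Θ)^{q−2} (∂ₖ(ψ∘Θ))²`
  (`∫ ∂ₖ(ψ(Θ)^{q−1} φₖ) = 0` with `φₖ = Dψ(Θ)[∂ₖΘ] = ∂ₖ(ψ∘Θ)`, the tree's Leibniz identity
  `∂ₖφₖ = D²ψ(Θ)[∂ₖΘ,∂ₖΘ] + Dψ(Θ)[∂ₖ∂ₖΘ]`, `∂ₖ(ψ(Θ)^{q−1}) = (q−1)ψ(Θ)^{q−2}φₖ`, and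
  `ψ^{q−1}D²ψ[∂ₖΘ,∂ₖΘ] ≥ 0`);
* **`ConvexWeight.integral_fderiv_rpow_laplacian_le`** — for `W = ψ^q` on the open `U ⊇ Θ(T^d)` and
  `q ≥ 0`: `∫ DW(Θ)[ΔΘ] ≤ −q(q−1) ∫ ψ(Θ)^{q−2} ∑ₖ(∂ₖ(ψ∘Θ))²`;
* **`ConvexWeight.integral_fderiv_rpow_laplacian_le_half`** — the same right-hand side written as
  `−(4(q−1)/q) ∫ ∑ₖ (∂ₖ(ψ(Θ)^{q/2}))²` (`q > 0`): the convexity gain with constant `4(q−1)/q`, positive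
  for every real `q > 1` (and `≥ 2`, i.e. at least the squared-weight gain, exactly when `q ≥ 2`).

Hypotheses: `ψ` of class `C²` on an open `U` containing the range of the smooth field `Θ`, `D²ψ(Θ y)`
positive semidefinite and `ψ(Θ y) > 0` at every `y` (as for the regularised weights `g̃_φ ∘ S` of the
template, which are positive by construction). What this does NOT do: it does not extend the `T_LD`
template below `q = 2` — its Z-anchor (T-2) (`StrainMoment.moment_q_le_interp`, `θ = 2q/(3q−2) ≤ 1 ⟺
q ≥ 2`) is not repairable below `2` as typed ((LL-BQ)); nothing about Lemma L-λ or Navier–Stokes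
regularity is claimed. [ours; folklore calculus]
-/

noncomputable section

open MeasureTheory Set Filter Topology Finset
open scoped ContDiff

namespace Summit.NavierStokesRegularity.FunctionalMining

open Literature.Analysis.FunctionSpaces Literature.Analysis.FunctionSpaces.Torus

namespace ConvexWeight

variable {d : Type*} [Fintype d] [DecidableEq d]
variable {E : Type*} [NormedAddCommGroup E] [NormedSpace ℝ E]

omit [DecidableEq d] in
/-- A real power of a positive `C¹` function on the torus is `C¹`. [folklore] -/
theorem isContDiff_one_rpow_of_pos {f : UnitAddTorus d → ℝ} (hf : IsContDiff 1 f)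
    (hpos : ∀ y, 0 < f y) (r : ℝ) : IsContDiff 1 (fun y => f y ^ r) := by
  unfold IsContDiff at hf ⊢
  exact hf.rpow_const_of_ne fun x => (hpos _).ne'

/-- **`∂ₖ(f^r) = r f^{r−1} ∂ₖf`** for a positive `C¹` function `f` on the torus (one-variable chain rule
along the coordinate line). [folklore] -/
theorem partialDeriv_rpow_of_pos {f : UnitAddTorus d → ℝ} (hf : IsContDiff 1 f)
    (hpos : ∀ y, 0 < f y) (r : ℝ) (k : d) (y : UnitAddTorus d) :
    partialDeriv k (fun z => f z ^ r) y = r * f y ^ (r - 1) * partialDeriv k f y := by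
  have h1 := hasDerivAt_line k hf y
  have h2 := hasDerivAt_line k (isContDiff_one_rpow_of_pos hf hpos r) y
  have h3 := h1.rpow_const (p := r) (Or.inl (hpos _).ne')
  have h := h2.unique h3
  rw [h, zero_smul, Torus.proj_zero, add_zero]
  ring

/-- **One direction of the power-weight convexity gain, with the gradient kept**: for `ψ` of class `C²`
on an open `U ⊇ Θ(T^d)` with `D²ψ(Θ y)[∂ₖΘ,∂ₖΘ] ≥ 0` and `ψ(Θ y) > 0`, and every real `r`
(think `r = q − 1`),
`∫ ψ(Θ)^r·Dψ(Θ)[∂ₖ∂ₖΘ] ≤ −r ∫ ψ(Θ)^{r−1} (∂ₖ(ψ∘Θ))²`. [ours; folklore calculus] -/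
theorem integral_rpow_mul_fderiv_partialDeriv_partialDeriv_le {U : Set E} (hU : IsOpen U) {ψ : E → ℝ}
    (hψ : ContDiffOn ℝ 2 ψ U) {Θ : UnitAddTorus d → E} (hΘ : IsSmooth Θ) (hmaps : ∀ y, Θ y ∈ U)
    (k : d) (hpsd : ∀ y, 0 ≤ (fderiv ℝ (fderiv ℝ ψ) (Θ y) (partialDeriv k Θ y)) (partialDeriv k Θ y))
    (hpos : ∀ y, 0 < ψ (Θ y)) (r : ℝ) :
    ∫ y, ψ (Θ y) ^ r * fderiv ℝ ψ (Θ y) (partialDeriv k (partialDeriv k Θ) y) ≤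
      -(r * ∫ y, ψ (Θ y) ^ (r - 1) * (partialDeriv k (fun z => ψ (Θ z)) y) ^ 2) := by
  have hψ1 : ContDiffOn ℝ 1 ψ U := hψ.of_le (by norm_num)
  -- the `C¹` factors `f = ψ ∘ Θ`, `g = f^r`, `φₖ = Dψ(Θ)[∂ₖΘ] = ∂ₖ f`
  set f : UnitAddTorus d → ℝ := fun z => ψ (Θ z) with hf
  set φ : UnitAddTorus d → ℝ := fun z => fderiv ℝ ψ (Θ z) (partialDeriv k Θ z) with hφ
  set g : UnitAddTorus d → ℝ := fun z => f z ^ r with hg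
  have hfpos : ∀ y, 0 < f y := hpos
  have hf1 : IsContDiff 1 f := isContDiff_one_comp hψ1 hΘ hmaps
  have hφ1 : IsContDiff 1 φ := isContDiff_one_fderiv_apply_partialDeriv hU hψ hΘ hmaps k
  have hg1 : IsContDiff 1 g := isContDiff_one_rpow_of_pos hf1 hfpos r
  have hfk : ∀ y, partialDeriv k f y = φ y := fun y => partialDeriv_comp_eq hU hψ1 hΘ hmaps k y
  have hgk : ∀ y, partialDeriv k g y = r * f y ^ (r - 1) * φ y := fun y => by
    rw [hg, partialDeriv_rpow_of_pos hf1 hfpos r k y, hfk y]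
  have hφk : ∀ y, partialDeriv k φ y =
      (fderiv ℝ (fderiv ℝ ψ) (Θ y) (partialDeriv k Θ y)) (partialDeriv k Θ y) +
        fderiv ℝ ψ (Θ y) (partialDeriv k (partialDeriv k Θ) y) := fun y =>
    partialDeriv_fderiv_apply_partialDeriv hU hψ hΘ hmaps k y
  -- `∫ ∂ₖ(g φ) = 0` and Leibniz
  have hzero := Torus.integral_partialDeriv_eq_zero_of_isContDiff
    (show IsContDiff 1 (fun y => g y * φ y) by
      unfold IsContDiff at hg1 hφ1 ⊢; exact hg1.mul hφ1) k
  have hleib : ∀ y, partialDeriv k (fun y => g y * φ y) y =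
      r * (f y ^ (r - 1) * φ y ^ 2) +
        (g y * (fderiv ℝ (fderiv ℝ ψ) (Θ y) (partialDeriv k Θ y)) (partialDeriv k Θ y) +
          g y * fderiv ℝ ψ (Θ y) (partialDeriv k (partialDeriv k Θ) y)) := by
    intro y
    rw [Torus.partialDeriv_mul hg1 hφ1 k y, hφk y, hgk y]
    ring
  simp_rw [hleib] at hzero
  -- continuity (integrability) of the pieces
  have hfc : Continuous f := hf1.continuous
  have hφc : Continuous φ := hφ1.continuous
  have hgc : Continuous g := hg1.continuous
  have hfrc : Continuous fun y => f y ^ (r - 1) := hfc.rpow_const fun y => Or.inl (hfpos y).ne'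
  have hi1 : Integrable (fun y => r * (f y ^ (r - 1) * φ y ^ 2)) :=
    ((hfrc.mul (hφc.pow 2)).const_mul r).integrable_unitAddTorus
  have hi2 : Integrable (fun y =>
      g y * (fderiv ℝ (fderiv ℝ ψ) (Θ y) (partialDeriv k Θ y)) (partialDeriv k Θ y)) :=
    (hgc.mul (continuous_hessian_apply hU hψ hΘ hmaps k)).integrable_unitAddTorus
  have hi3 : Integrable (fun y => g y * fderiv ℝ ψ (Θ y) (partialDeriv k (partialDeriv k Θ) y)) :=
    (hgc.mul (continuous_fderiv_apply hU hψ hΘ hmaps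
      ((hΘ.partialDeriv k).partialDeriv k).continuous)).integrable_unitAddTorus
  have hi23 : Integrable (fun y =>
      g y * (fderiv ℝ (fderiv ℝ ψ) (Θ y) (partialDeriv k Θ y)) (partialDeriv k Θ y) +
        g y * fderiv ℝ ψ (Θ y) (partialDeriv k (partialDeriv k Θ) y)) := hi2.add hi3
  rw [integral_add hi1 hi23, integral_add hi2 hi3, integral_const_mul] at hzero
  -- the Hessian piece is non-negative
  have hnn : 0 ≤ ∫ y, g y * (fderiv ℝ (fderiv ℝ ψ) (Θ y) (partialDeriv k Θ y)) (partialDeriv k Θ y) :=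
    integral_nonneg fun y => mul_nonneg (Real.rpow_nonneg (hfpos y).le _) (hpsd y)
  have hsq : ∫ y, f y ^ (r - 1) * (partialDeriv k f y) ^ 2 = ∫ y, f y ^ (r - 1) * φ y ^ 2 :=
    integral_congr_ae (ae_of_all _ fun y => by simp only [hfk y])
  rw [hsq]
  have e : ∫ y, ψ (Θ y) ^ r * fderiv ℝ ψ (Θ y) (partialDeriv k (partialDeriv k Θ) y) =
      ∫ y, g y * fderiv ℝ ψ (Θ y) (partialDeriv k (partialDeriv k Θ) y) := rfl
  rw [e]
  linarith

/-- The derivative of `W = ψ^q` at a point of `U` where `ψ > 0`: `DW(z)[w] = q ψ(z)^{q−1} Dψ(z)[w]`,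
for any `W` that agrees with `ψ^q` on the open set `U`. [folklore] -/
theorem fderiv_rpow_apply {U : Set E} (hU : IsOpen U) {ψ W : E → ℝ} {q : ℝ} (hψ : ContDiffOn ℝ 1 ψ U)
    (hW : ∀ z ∈ U, W z = ψ z ^ q) {z : E} (hz : z ∈ U) (hpos : 0 < ψ z) (w : E) :
    fderiv ℝ W z w = q * ψ z ^ (q - 1) * fderiv ℝ ψ z w := by
  have hd : DifferentiableAt ℝ ψ z :=
    (hψ.differentiableOn (by simp)).differentiableAt (hU.mem_nhds hz)
  have h1 : HasFDerivAt (fun x => ψ x ^ q) ((q * ψ z ^ (q - 1)) • fderiv ℝ ψ z) z :=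
    hd.hasFDerivAt.rpow_const (p := q) (Or.inl hpos.ne')
  have heq : W =ᶠ[𝓝 z] fun x => ψ x ^ q := by
    filter_upwards [hU.mem_nhds hz] with x hx using hW x hx
  rw [heq.fderiv_eq, h1.fderiv]
  simp [smul_eq_mul]

/-- **POWER weights, every real `q ≥ 0`**: if `W = ψ^q` on an open `U ⊇ Θ(T^d)`, `ψ` of class `C²` on
`U` with positive semidefinite second derivative at the values of `Θ` and `ψ(Θ) > 0`, then
`∫ DW(Θ)[ΔΘ] ≤ −q(q−1) ∫ ψ(Θ)^{q−2} ∑ₖ (∂ₖ(ψ∘Θ))²`. For `0 ≤ q < 1` the right-hand side is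
non-negative and the bound is empty; for `q > 1` it is the convexity gain. [ours; the (T-1) repair of
§14d (LL-BQ), generic form] -/
theorem integral_fderiv_rpow_laplacian_le {U : Set E} (hU : IsOpen U) {ψ W : E → ℝ} {q : ℝ}
    (hq : 0 ≤ q) (hψ : ContDiffOn ℝ 2 ψ U) (hW : ∀ z ∈ U, W z = ψ z ^ q) {Θ : UnitAddTorus d → E}
    (hΘ : IsSmooth Θ) (hmaps : ∀ y, Θ y ∈ U)
    (hpsd : ∀ y (w : E), 0 ≤ (fderiv ℝ (fderiv ℝ ψ) (Θ y) w) w) (hpos : ∀ y, 0 < ψ (Θ y)) :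
    ∫ y, fderiv ℝ W (Θ y) (Torus.laplacian Θ y) ≤
      -(q * (q - 1)) * ∫ y, ψ (Θ y) ^ (q - 2) * ∑ k, (partialDeriv k (fun z => ψ (Θ z)) y) ^ 2 := by
  have hψ1 : ContDiffOn ℝ 1 ψ U := hψ.of_le (by norm_num)
  have hf1 : IsContDiff 1 (fun z => ψ (Θ z)) := isContDiff_one_comp hψ1 hΘ hmaps
  have hfc : Continuous (fun z => ψ (Θ z)) := hf1.continuous
  -- `DW(Θ)[ΔΘ] = ∑ₖ q ψ^{q−1} Dψ(Θ)[∂ₖ∂ₖΘ]`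
  have hlap : ∀ y, fderiv ℝ W (Θ y) (Torus.laplacian Θ y) =
      ∑ k, q * (ψ (Θ y) ^ (q - 1) * fderiv ℝ ψ (Θ y) (partialDeriv k (partialDeriv k Θ) y)) := by
    intro y
    rw [fderiv_rpow_apply hU hψ1 hW (hmaps y) (hpos y),
      Torus.laplacian_eq_sum_partialDeriv_partialDeriv hΘ y, map_sum, Finset.mul_sum]
    refine Finset.sum_congr rfl fun k _ => ?_
    ring
  simp_rw [hlap]
  have hgc : Continuous fun y => ψ (Θ y) ^ (q - 1) := hfc.rpow_const fun y => Or.inl (hpos y).ne'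
  have hik : ∀ k, Integrable (fun y =>
      q * (ψ (Θ y) ^ (q - 1) * fderiv ℝ ψ (Θ y) (partialDeriv k (partialDeriv k Θ) y))) := fun k =>
    ((hgc.mul (continuous_fderiv_apply hU hψ hΘ hmaps
      ((hΘ.partialDeriv k).partialDeriv k).continuous)).const_mul q).integrable_unitAddTorus
  -- the right-hand side, summand by summand
  have hg2c : Continuous fun y => ψ (Θ y) ^ (q - 2) := hfc.rpow_const fun y => Or.inl (hpos y).ne'
  have hik' : ∀ k, Integrable (fun y =>
      ψ (Θ y) ^ (q - 2) * (partialDeriv k (fun z => ψ (Θ z)) y) ^ 2) := by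
    intro k
    have e : (fun y => ψ (Θ y) ^ (q - 2) * (partialDeriv k (fun z => ψ (Θ z)) y) ^ 2) =
        fun y => ψ (Θ y) ^ (q - 2) * (fderiv ℝ ψ (Θ y) (partialDeriv k Θ y)) ^ 2 :=
      funext fun y => by rw [partialDeriv_comp_eq hU hψ1 hΘ hmaps k y]
    rw [e]
    exact (hg2c.mul ((continuous_fderiv_apply hU hψ hΘ hmaps
      (hΘ.partialDeriv k).continuous).pow 2)).integrable_unitAddTorus
  have hsum : ∫ y, ψ (Θ y) ^ (q - 2) * ∑ k, (partialDeriv k (fun z => ψ (Θ z)) y) ^ 2 =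
      ∑ k, ∫ y, ψ (Θ y) ^ (q - 2) * (partialDeriv k (fun z => ψ (Θ z)) y) ^ 2 := by
    rw [← integral_finsetSum _ fun k _ => hik' k]
    exact integral_congr_ae (ae_of_all _ fun y => by simp only [Finset.mul_sum])
  rw [integral_finsetSum _ fun k _ => hik k, hsum, Finset.mul_sum]
  refine Finset.sum_le_sum fun k _ => ?_
  rw [integral_const_mul]
  have h := integral_rpow_mul_fderiv_partialDeriv_partialDeriv_le hU hψ hΘ hmaps k
    (fun y => hpsd y _) hpos (q - 1)
  rw [show q - 1 - 1 = q - 2 by ring] at h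
  have hmul := mul_le_mul_of_nonneg_left h hq
  calc q * ∫ y, ψ (Θ y) ^ (q - 1) * fderiv ℝ ψ (Θ y) (partialDeriv k (partialDeriv k Θ) y)
      ≤ q * -((q - 1) * ∫ y, ψ (Θ y) ^ (q - 2) * (partialDeriv k (fun z => ψ (Θ z)) y) ^ 2) := hmul
    _ = -(q * (q - 1)) * ∫ y, ψ (Θ y) ^ (q - 2) * (partialDeriv k (fun z => ψ (Θ z)) y) ^ 2 := by
        ring

/-- **The same gain through `ψ^{q/2}`**: `q(q−1)ψ^{q−2}(∂ₖ(ψ∘Θ))² = (4(q−1)/q)(∂ₖ(ψ(Θ)^{q/2}))²`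
pointwise (`q > 0`), hence `∫ DW(Θ)[ΔΘ] ≤ −(4(q−1)/q) ∫ ∑ₖ (∂ₖ(ψ(Θ)^{q/2}))²` — the convexity gain of
SIEVELD §3.4 (b) for the power weight `ψ^q` with constant `4(q−1)/q`, for every real `q > 0` (positive
gain iff `q > 1`; `4(q−1)/q ≥ 2` iff `q ≥ 2`, where `ConvexWeightGradient.integral_fderiv_sq_laplacian_le`
with the convex factor `ψ^{q/2}` gives `2`). [ours; the (T-1) repair of §14d (LL-BQ)] -/
theorem integral_fderiv_rpow_laplacian_le_half {U : Set E} (hU : IsOpen U) {ψ W : E → ℝ} {q : ℝ}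
    (hq : 0 < q) (hψ : ContDiffOn ℝ 2 ψ U) (hW : ∀ z ∈ U, W z = ψ z ^ q) {Θ : UnitAddTorus d → E}
    (hΘ : IsSmooth Θ) (hmaps : ∀ y, Θ y ∈ U)
    (hpsd : ∀ y (w : E), 0 ≤ (fderiv ℝ (fderiv ℝ ψ) (Θ y) w) w) (hpos : ∀ y, 0 < ψ (Θ y)) :
    ∫ y, fderiv ℝ W (Θ y) (Torus.laplacian Θ y) ≤
      -(4 * (q - 1) / q) * ∫ y, ∑ k, (partialDeriv k (fun z => ψ (Θ z) ^ (q / 2)) y) ^ 2 := by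
  have hψ1 : ContDiffOn ℝ 1 ψ U := hψ.of_le (by norm_num)
  have hf1 : IsContDiff 1 (fun z => ψ (Θ z)) := isContDiff_one_comp hψ1 hΘ hmaps
  have h := integral_fderiv_rpow_laplacian_le hU hq.le hψ hW hΘ hmaps hpsd hpos
  -- pointwise: `(∂ₖ(f^{q/2}))² = (q/2)² f^{q−2} (∂ₖf)²`
  have hpt : ∀ y, ∑ k, (partialDeriv k (fun z => ψ (Θ z) ^ (q / 2)) y) ^ 2 =
      (q / 2) ^ 2 * (ψ (Θ y) ^ (q - 2) * ∑ k, (partialDeriv k (fun z => ψ (Θ z)) y) ^ 2) := by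
    intro y
    rw [Finset.mul_sum, Finset.mul_sum]
    refine Finset.sum_congr rfl fun k _ => ?_
    rw [partialDeriv_rpow_of_pos hf1 hpos (q / 2) k y]
    have e2 : (ψ (Θ y) ^ (q / 2 - 1)) ^ 2 = ψ (Θ y) ^ (q - 2) := by
      rw [← Real.rpow_natCast, ← Real.rpow_mul (hpos y).le]
      congr 1
      push_cast
      ring
    calc (q / 2 * ψ (Θ y) ^ (q / 2 - 1) * partialDeriv k (fun z => ψ (Θ z)) y) ^ 2
        = (q / 2) ^ 2 * (ψ (Θ y) ^ (q / 2 - 1)) ^ 2 * (partialDeriv k (fun z => ψ (Θ z)) y) ^ 2 := by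
          ring
      _ = (q / 2) ^ 2 * (ψ (Θ y) ^ (q - 2) * (partialDeriv k (fun z => ψ (Θ z)) y) ^ 2) := by
          rw [e2]; ring
  have hI : ∫ y, ∑ k, (partialDeriv k (fun z => ψ (Θ z) ^ (q / 2)) y) ^ 2 =
      (q / 2) ^ 2 * ∫ y, ψ (Θ y) ^ (q - 2) * ∑ k, (partialDeriv k (fun z => ψ (Θ z)) y) ^ 2 := by
    rw [← integral_const_mul]
    exact integral_congr_ae (ae_of_all _ fun y => hpt y)
  rw [hI]
  have e : -(4 * (q - 1) / q) * ((q / 2) ^ 2 *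
      ∫ y, ψ (Θ y) ^ (q - 2) * ∑ k, (partialDeriv k (fun z => ψ (Θ z)) y) ^ 2) =
      -(q * (q - 1)) * ∫ y, ψ (Θ y) ^ (q - 2) * ∑ k, (partialDeriv k (fun z => ψ (Θ z)) y) ^ 2 := by
    field_simp
    ring
  rw [e]
  exact h

end ConvexWeight

end Summit.NavierStokesRegularity.FunctionalMining

end
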